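import Summits.CriticalPhenomena.PercolationContinuityZ3.Theorems.PercNearOneGluingNoHeavyLowerTailSahiGridPatternTwoCoord
import Summits.CriticalPhenomena.PercolationContinuityZ3.Theorems.PercNearOneGluingNoHeavyLowerTailSahiGridPatternIndepSlots
import Summits.CriticalPhenomena.PercolationContinuityZ3.Theorems.PercNearOneGluingNoHeavyLowerTailThreePartitionLift
import Summits.CriticalPhenomena.PercolationContinuityZ3.Theorems.PercNearOneGluingNoHeavyLowerTailThreePartitionCombBridge

/-!
# `NoHeavyLowerTail` (crux stmt-CriticalPhenomena-4575), Sahi programme: **TWISTED SHADOWS — the pattern conjecture implies twisted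
# three-partition positivity and hence comb positivity of `E₃`** (`PatternPos ⟹ (★★) ⟹ (M⁺-3)`), with unconditional twisted strata

Support file (seat `prim-sahi-p1`, generation 10; `--supports stmt-CriticalPhenomena-4575`).  Pure proofs, no definitions, no `sorry`, standard axioms.
Vocabulary: `…SahiGridPattern{,TwoCoord,IndepSlots}` (`Pd`, `sStarD`, `col`, `hZ`, `ind`, `PatternPos`, `sStarD_nonneg_of_twoCoord`, `sStarD_nonneg_of_indepSlots`),
`…ThreePartitionAD{,Twisted}`, `…ThreePartitionLift` (`tri`, `triT`, `topT`, `deeT`, `teeT`, `threePartNT`, `ThreePartitionPositivityTwisted`, `tri_congr`,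
`compl_union_compl_union_eq`), `…ThreePartitionCombBridge` (`masterFamilyCombPos_three_of_threePartitionPositivityTwisted`).

THE MATHEMATICS.  Fix a twist `τ ⊆ [d]`.  The TWISTED SHADOW of a family `𝒰 ⊆ 𝒫([d])` is `A^τ_𝒰 := {x ∈ [3]^d : U_τ(x) ∈ 𝒰}`,
`U_τ(x) := {a ∉ τ : x_a = 2} ∪ {a ∈ τ : x_a ≠ 0}` (monotone in `x`, so `A^τ_𝒰` is an up-set when `𝒰` is).  For a Latin triple of `[3]^d` the parts
`P_c := {a ∉ τ : copy c has value 2} ∪ {a ∈ τ : copy c has value 0}` form an ordered 3-partition of `[d]` with `U_τ(copy c) = P_c ∆ τ` — off `τ` one copy is 'up',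
on `τ` two copies are — each partition arising from `2^d` Latin triples (`card_fibre_parts`).  Hence **`sStarD_twistedShadow_eq`**:
  `sStarD A^τ_𝒰 A^τ_𝒱 A^τ_𝒲 = 2^d · threePartNT τ 𝒰 𝒱 𝒲`   for ALL families and twists
(`threePartNT` = the twisted three-partition functional of `…ThreePartitionADTwisted`, `= ⅙ ×` the three-copy fibre sum of `E₃` on the profile 'τ open in two copies').
CONSEQUENCES.  `threePartNT_nonneg_of_patternPos` (`PatternPos d ⟹ threePartNT τ 𝒰 𝒱 𝒲 ≥ 0` for all twists and up-set families on `Fin d`); transport along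
`Fintype.equivFin` (`threePartNT_image_equiv`) gives **`threePartitionPositivityTwisted_of_forall_patternPos : (∀ d, PatternPos d) → ThreePartitionPositivityTwisted`**
and so **`masterFamilyCombPos_three_of_forall_patternPos : (∀ d, PatternPos d) → MasterFamilyCombPos 3`** — the pattern conjecture (p1) implies the twisted three-partition
conjecture (★★) (prim-l12 / prim-ineq-gen-4) implies comb positivity of `E₃` on cubes (M⁺-3) (prim-masterthm), formally.  Unconditionally, the pattern-side slot
theorems give twisted strata: `threePartNT_nonneg_of_twoCoord` (one family decided by two elements), `threePartNT_nonneg_of_indepSlots` (two families measurable w.r.t.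
complementary blocks), every twist.
HONEST LABEL: all four conjectures (`PatternPos d`, `d ≥ 4`; (★★); (M⁺-3); Kahn / Sahi `C₃`) remain OPEN; nothing here asserts them. [this work]
-/

noncomputable section

open Finset
open scoped Classical symmDiff

namespace Summit.CriticalPhenomena.PercolationContinuityZ3.Theorems.SahiGridPattern

open SahiGrid3 (ind hZ)
open Summit.CriticalPhenomena.PercolationContinuityZ3.Theorems.ThreePartition

variable {d : ℕ}

/-! ### Symmetries of the partition count -/

/-- Swapping parts 1 and 2 in a partition count. [this work] -/
theorem tri_swap12' {ι : Type*} [Fintype ι] (p : Set ι → Set ι → Set ι → Prop) :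
    ThreePartition.tri p = ThreePartition.tri fun S₁ S₂ S₃ => p S₂ S₁ S₃ := by
  unfold ThreePartition.tri
  refine card_bij' (fun q _ => (q.2, q.1)) (fun q _ => (q.2, q.1)) ?_ ?_ (fun q _ => rfl) (fun q _ => rfl)
  · intro q hq
    simp only [mem_filter, mem_univ, true_and] at hq ⊢
    exact ⟨hq.1.symm, by rw [Set.union_comm]; exact hq.2⟩
  · intro q hq
    simp only [mem_filter, mem_univ, true_and] at hq ⊢
    exact ⟨hq.1.symm, by rw [Set.union_comm]; exact hq.2⟩

/-- Swapping parts 1 and 3 in a partition count. [this work] -/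
theorem tri_swap13' {ι : Type*} [Fintype ι] (p : Set ι → Set ι → Set ι → Prop) :
    ThreePartition.tri p = ThreePartition.tri fun S₁ S₂ S₃ => p S₃ S₂ S₁ := by
  unfold ThreePartition.tri
  refine card_bij' (fun q _ => ((q.1 ∪ q.2)ᶜ, q.2)) (fun q _ => ((q.1 ∪ q.2)ᶜ, q.2)) ?_ ?_ ?_ ?_
  · intro q hq
    simp only [mem_filter, mem_univ, true_and] at hq ⊢
    obtain ⟨hd, hp⟩ := hq
    refine ⟨Set.disjoint_left.2 fun x hx hx2 => hx (Or.inr hx2), ?_⟩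
    rw [compl_union_compl_union_eq hd]; exact hp
  · intro q hq
    simp only [mem_filter, mem_univ, true_and] at hq ⊢
    obtain ⟨hd, hp⟩ := hq
    refine ⟨Set.disjoint_left.2 fun x hx hx2 => hx (Or.inr hx2), ?_⟩
    rw [compl_union_compl_union_eq hd]; exact hp
  · intro q hq
    simp only [mem_filter, mem_univ, true_and] at hq
    exact Prod.ext (compl_union_compl_union_eq hq.1) rfl
  · intro q hq
    simp only [mem_filter, mem_univ, true_and] at hq
    exact Prod.ext (compl_union_compl_union_eq hq.1) rfl

/-- A partition count as a sum of an indicator over all pairs. [this work] -/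
theorem tri_eq_sum' {ι : Type*} [Fintype ι] (p : Set ι → Set ι → Set ι → Prop) :
    (ThreePartition.tri p : ℤ) = ∑ q : Set ι × Set ι, if Disjoint q.1 q.2 ∧ p q.1 q.2 (q.1 ∪ q.2)ᶜ then (1:ℤ) else 0 := by
  unfold ThreePartition.tri
  rw [Finset.card_filter]
  push_cast
  exact Finset.sum_congr rfl fun q _ => if_congr Iff.rfl rfl rfl

/-- The twisted functional with every count written as a `tri` of a predicate in the order (part 1, part 2, part 3). [this work] -/
theorem threePartNT_eq_tri (τ : Set (Fin d)) (𝒰 𝒱 𝒲 : Set (Set (Fin d))) :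
    threePartNT τ 𝒰 𝒱 𝒲 =
      2 * (ThreePartition.tri (fun S₁ _ _ : Set (Fin d) => S₁ ∆ τ ∈ 𝒰 ∩ 𝒱 ∩ 𝒲) : ℤ)
        + (ThreePartition.tri (fun S₁ S₂ S₃ : Set (Fin d) => S₁ ∆ τ ∈ 𝒰 ∧ S₂ ∆ τ ∈ 𝒱 ∧ S₃ ∆ τ ∈ 𝒲) : ℤ)
        - (ThreePartition.tri (fun S₁ S₂ _ : Set (Fin d) => S₁ ∆ τ ∈ 𝒰 ∧ S₂ ∆ τ ∈ 𝒱 ∩ 𝒲) : ℤ)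
        - (ThreePartition.tri (fun S₁ S₂ _ : Set (Fin d) => S₁ ∆ τ ∈ 𝒱 ∧ S₂ ∆ τ ∈ 𝒰 ∩ 𝒲) : ℤ)
        - (ThreePartition.tri (fun S₁ S₂ _ : Set (Fin d) => S₁ ∆ τ ∈ 𝒲 ∧ S₂ ∆ τ ∈ 𝒰 ∩ 𝒱) : ℤ) := by
  have htop : topT τ (𝒰 ∩ 𝒱 ∩ 𝒲) = ThreePartition.tri (fun S₁ _ _ : Set (Fin d) => S₁ ∆ τ ∈ 𝒰 ∩ 𝒱 ∩ 𝒲) := by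
    unfold topT triT; rw [tri_swap13']
  have hdee : ∀ 𝒜 ℬ : Set (Set (Fin d)), deeT τ 𝒜 ℬ = ThreePartition.tri (fun S₁ S₂ _ : Set (Fin d) => S₁ ∆ τ ∈ 𝒜 ∧ S₂ ∆ τ ∈ ℬ) := by
    intro 𝒜 ℬ
    unfold deeT triT
    rw [tri_swap12' (fun S₁ S₂ S₃ : Set (Fin d) => S₁ ∆ τ ∈ 𝒜 ∧ S₃ ∆ τ ∈ ℬ),
      tri_swap13' (fun S₁ S₂ S₃ : Set (Fin d) => S₂ ∆ τ ∈ 𝒜 ∧ S₃ ∆ τ ∈ ℬ),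
      tri_swap12' (fun S₁ S₂ S₃ : Set (Fin d) => S₂ ∆ τ ∈ 𝒜 ∧ S₁ ∆ τ ∈ ℬ)]
  have htee : teeT τ 𝒰 𝒱 𝒲 = ThreePartition.tri (fun S₁ S₂ S₃ : Set (Fin d) => S₁ ∆ τ ∈ 𝒰 ∧ S₂ ∆ τ ∈ 𝒱 ∧ S₃ ∆ τ ∈ 𝒲) := rfl
  unfold threePartNT
  rw [htop, hdee, hdee, hdee, htee]
  push_cast
  ring

/-- Splitting a conjunction indicator, for any `Decidable` instances. [this work] -/
theorem ite_and_eq_mul_any (P Q : Prop) [Decidable P] [Decidable Q] [Decidable (P ∧ Q)] :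
    (if (P ∧ Q) then (1:ℤ) else 0) = (if P then (1:ℤ) else 0) * (if Q then (1:ℤ) else 0) := by
  by_cases hP : P <;> by_cases hQ : Q <;> simp [hP, hQ]

/-! ### The parts of a Latin triple -/

/-- In `S₃`: `σ 2 = v ↔ σ 0 ≠ v ∧ σ 1 ≠ v`. [this work] -/
theorem perm_two_eq_iff (σ : Equiv.Perm (Fin 3)) (v : Fin 3) : σ 2 = v ↔ (σ 0 ≠ v ∧ σ 1 ≠ v) := by
  constructor
  · intro h
    exact ⟨fun h0 => absurd (σ.injective (h0.trans h.symm)) (by decide), fun h1 => absurd (σ.injective (h1.trans h.symm)) (by decide)⟩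
  · rintro ⟨h0, h1⟩
    obtain ⟨c, hc⟩ := σ.surjective v
    have : c = 2 := by
      fin_cases c
      · exact absurd hc h0
      · exact absurd hc h1
      · rfl
    subst this; exact hc

/-- Per-axis fibre counts: the number of `σ ∈ S₃` with prescribed truth values of `σ 0 = v`, `σ 1 = v`. [this work] -/
theorem card_perm_fibre_val (v : Fin 3) (P Q : Prop) :
    (univ.filter fun σ : Equiv.Perm (Fin 3) => (σ 0 = v ↔ P) ∧ (σ 1 = v ↔ Q)).card = if P ∧ Q then 0 else 2 := by
  by_cases hP : P <;> by_cases hQ : Q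
  · simp only [hP, hQ, iff_true, and_self, if_true]
    rw [Finset.card_eq_zero, Finset.filter_eq_empty_iff]
    rintro σ - ⟨h0, h1⟩
    exact absurd (σ.injective (h0.trans h1.symm)) (by decide)
  · simp only [hP, hQ, iff_true, iff_false, and_false, if_false]
    fin_cases v <;> decide
  · simp only [hP, hQ, iff_true, iff_false, false_and, if_false]
    fin_cases v <;> decide
  · simp only [hP, hQ, iff_false, and_self, if_false]
    fin_cases v <;> decide

/-- The twisted part of copy `c`: `{a ∉ τ : value 2} ∪ {a ∈ τ : value 0}`; the third part is the complement of the first two. [this work] -/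
theorem part_col_two (τ : Set (Fin d)) (π : Fin d → Equiv.Perm (Fin 3)) :
    {a : Fin d | (a ∉ τ ∧ col π 2 a = 2) ∨ (a ∈ τ ∧ col π 2 a = 0)} =
      ({a : Fin d | (a ∉ τ ∧ col π 0 a = 2) ∨ (a ∈ τ ∧ col π 0 a = 0)} ∪ {a : Fin d | (a ∉ τ ∧ col π 1 a = 2) ∨ (a ∈ τ ∧ col π 1 a = 0)})ᶜ := by
  ext a
  simp only [Set.mem_setOf_eq, Set.mem_compl_iff, Set.mem_union, col]
  by_cases ha : a ∈ τ
  · have h := perm_two_eq_iff (π a) 0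
    tauto
  · have h := perm_two_eq_iff (π a) 2
    tauto

/-- **Each ordered 3-partition comes from exactly `2^d` Latin triples** (twisted parts). [this work] -/
theorem card_fibre_parts (τ : Set (Fin d)) (S₁ S₂ : Set (Fin d)) :
    (univ.filter fun π : Fin d → Equiv.Perm (Fin 3) =>
        ({a : Fin d | (a ∉ τ ∧ col π 0 a = 2) ∨ (a ∈ τ ∧ col π 0 a = 0)},
          {a : Fin d | (a ∉ τ ∧ col π 1 a = 2) ∨ (a ∈ τ ∧ col π 1 a = 0)}) = (S₁, S₂)).card =
      if Disjoint S₁ S₂ then 2 ^ d else 0 := by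
  -- per-axis designated value
  have key : ∀ a : Fin d, (univ.filter fun σ : Equiv.Perm (Fin 3) =>
      (((a ∉ τ ∧ σ 0 = 2) ∨ (a ∈ τ ∧ σ 0 = 0)) ↔ a ∈ S₁) ∧ (((a ∉ τ ∧ σ 1 = 2) ∨ (a ∈ τ ∧ σ 1 = 0)) ↔ a ∈ S₂)).card =
      if (a ∈ S₁ ∧ a ∈ S₂) then 0 else 2 := by
    intro a
    by_cases ha : a ∈ τ
    · rw [← card_perm_fibre_val 0 (a ∈ S₁) (a ∈ S₂)]
      congr 1
      refine Finset.filter_congr fun σ _ => ?_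
      simp only [ha, not_true_eq_false, false_and, true_and, false_or]
    · rw [← card_perm_fibre_val 2 (a ∈ S₁) (a ∈ S₂)]
      congr 1
      refine Finset.filter_congr fun σ _ => ?_
      simp only [ha, not_false_eq_true, true_and, false_and, or_false]
  have e : (univ.filter fun π : Fin d → Equiv.Perm (Fin 3) =>
        ({a : Fin d | (a ∉ τ ∧ col π 0 a = 2) ∨ (a ∈ τ ∧ col π 0 a = 0)},
          {a : Fin d | (a ∉ τ ∧ col π 1 a = 2) ∨ (a ∈ τ ∧ col π 1 a = 0)}) = (S₁, S₂)) =
      Fintype.piFinset fun a => univ.filter fun σ : Equiv.Perm (Fin 3) =>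
        (((a ∉ τ ∧ σ 0 = 2) ∨ (a ∈ τ ∧ σ 0 = 0)) ↔ a ∈ S₁) ∧ (((a ∉ τ ∧ σ 1 = 2) ∨ (a ∈ τ ∧ σ 1 = 0)) ↔ a ∈ S₂) := by
    ext π
    simp only [Finset.mem_filter, Finset.mem_univ, true_and, Fintype.mem_piFinset, Prod.mk.injEq, Set.ext_iff, Set.mem_setOf_eq, col]
    exact ⟨fun ⟨h0, h1⟩ a => ⟨h0 a, h1 a⟩, fun h => ⟨fun a => (h a).1, fun a => (h a).2⟩⟩
  rw [e, Fintype.card_piFinset]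
  simp only [key]
  by_cases hd : Disjoint S₁ S₂
  · rw [if_pos hd]
    have : ∀ a : Fin d, (if (a ∈ S₁ ∧ a ∈ S₂) then 0 else 2) = 2 := by
      intro a
      rw [if_neg]
      rintro ⟨h1, h2⟩
      exact (Set.disjoint_iff.1 hd) ⟨h1, h2⟩
    rw [Finset.prod_congr rfl fun a _ => this a, Finset.prod_const, Finset.card_univ, Fintype.card_fin]
  · rw [if_neg hd]
    rw [Set.not_disjoint_iff] at hd
    obtain ⟨a, h1, h2⟩ := hd
    exact Finset.prod_eq_zero (Finset.mem_univ a) (by rw [if_pos ⟨h1, h2⟩])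

/-- `U_τ(copy c) = P_c ∆ τ`: the twisted up-set of a copy is its part twisted by `τ`. [this work] -/
theorem twistedSet_col_eq (τ : Set (Fin d)) (π : Fin d → Equiv.Perm (Fin 3)) (c : Fin 3) :
    {a : Fin d | (a ∉ τ ∧ col π c a = 2) ∨ (a ∈ τ ∧ col π c a ≠ 0)} =
      {a : Fin d | (a ∉ τ ∧ col π c a = 2) ∨ (a ∈ τ ∧ col π c a = 0)} ∆ τ := by
  ext a
  rw [Set.mem_symmDiff]
  simp only [Set.mem_setOf_eq]
  by_cases ha : a ∈ τ <;> tauto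

/-- Indicator of a twisted shadow set at a column of a Latin triple. [this work] -/
theorem ind_twistedShadow_col (τ : Set (Fin d)) {𝒰 : Set (Set (Fin d))} {A : Finset (Pd d)}
    (hA : ∀ x : Pd d, x ∈ A ↔ {a : Fin d | (a ∉ τ ∧ x a = 2) ∨ (a ∈ τ ∧ x a ≠ 0)} ∈ 𝒰)
    (π : Fin d → Equiv.Perm (Fin 3)) (c : Fin 3) :
    ind A (col π c) = if {a : Fin d | (a ∉ τ ∧ col π c a = 2) ∨ (a ∈ τ ∧ col π c a = 0)} ∆ τ ∈ 𝒰 then 1 else 0 := by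
  unfold ind
  rw [← twistedSet_col_eq]
  exact if_congr (hA _) rfl rfl

/-- **THE TWISTED SHADOW IDENTITY**: for every twist `τ` and all families `𝒰, 𝒱, 𝒲 ⊆ 𝒫([d])`, with twisted shadows `A^τ_𝒰 = {x : U_τ(x) ∈ 𝒰}`,
`sStarD A^τ_𝒰 A^τ_𝒱 A^τ_𝒲 = 2^d · threePartNT τ 𝒰 𝒱 𝒲`. [this work] -/
theorem sStarD_twistedShadow_eq (τ : Set (Fin d)) (𝒰 𝒱 𝒲 : Set (Set (Fin d))) {A B C : Finset (Pd d)}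
    (hA : ∀ x : Pd d, x ∈ A ↔ {a : Fin d | (a ∉ τ ∧ x a = 2) ∨ (a ∈ τ ∧ x a ≠ 0)} ∈ 𝒰)
    (hB : ∀ x : Pd d, x ∈ B ↔ {a : Fin d | (a ∉ τ ∧ x a = 2) ∨ (a ∈ τ ∧ x a ≠ 0)} ∈ 𝒱)
    (hC : ∀ x : Pd d, x ∈ C ↔ {a : Fin d | (a ∉ τ ∧ x a = 2) ∨ (a ∈ τ ∧ x a ≠ 0)} ∈ 𝒲) :
    sStarD A B C = 2 ^ d * threePartNT τ 𝒰 𝒱 𝒲 := by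
  let a𝒰 : Set (Fin d) → ℤ := fun S => if S ∆ τ ∈ 𝒰 then 1 else 0
  let a𝒱 : Set (Fin d) → ℤ := fun S => if S ∆ τ ∈ 𝒱 then 1 else 0
  let a𝒲 : Set (Fin d) → ℤ := fun S => if S ∆ τ ∈ 𝒲 then 1 else 0
  let K : Set (Fin d) × Set (Fin d) → ℤ := fun q =>
    2 * (a𝒰 q.1 * a𝒱 q.1 * a𝒲 q.1) - a𝒰 q.1 * a𝒱 q.2 * a𝒲 q.2 - a𝒱 q.1 * a𝒰 q.2 * a𝒲 q.2 - a𝒲 q.1 * a𝒰 q.2 * a𝒱 q.2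
      + a𝒰 q.1 * a𝒱 q.2 * a𝒲 (q.1 ∪ q.2)ᶜ
  let Φ : (Fin d → Equiv.Perm (Fin 3)) → Set (Fin d) × Set (Fin d) := fun π =>
    ({a | (a ∉ τ ∧ col π 0 a = 2) ∨ (a ∈ τ ∧ col π 0 a = 0)}, {a | (a ∉ τ ∧ col π 1 a = 2) ∨ (a ∈ τ ∧ col π 1 a = 0)})
  have hker : ∀ π : Fin d → Equiv.Perm (Fin 3), hZ A B C (col π 0) (col π 1) (col π 2) = K (Φ π) := by
    intro π
    unfold hZ
    rw [ind_twistedShadow_col τ hA π 0, ind_twistedShadow_col τ hA π 1, ind_twistedShadow_col τ hB π 0, ind_twistedShadow_col τ hB π 1,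
      ind_twistedShadow_col τ hC π 0, ind_twistedShadow_col τ hC π 1, ind_twistedShadow_col τ hC π 2, part_col_two]
  -- fibre counting
  have hsum : sStarD A B C = 2 ^ d * ∑ q : Set (Fin d) × Set (Fin d), (if Disjoint q.1 q.2 then (1:ℤ) else 0) * K q := by
    unfold sStarD
    rw [Finset.sum_congr rfl fun π _ => hker π, ← Finset.sum_fiberwise univ Φ (fun π => K (Φ π)), Finset.mul_sum]
    refine Finset.sum_congr rfl fun q _ => ?_
    rw [Finset.sum_congr rfl fun π hπ => by rw [(Finset.mem_filter.1 hπ).2], Finset.sum_const, nsmul_eq_mul]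
    obtain ⟨S₁, S₂⟩ := q
    rw [card_fibre_parts τ S₁ S₂]
    split_ifs <;> simp
  -- the twisted three-partition functional as a sum over pairs
  have hN : threePartNT τ 𝒰 𝒱 𝒲 = ∑ q : Set (Fin d) × Set (Fin d), (if Disjoint q.1 q.2 then (1:ℤ) else 0) * K q := by
    rw [threePartNT_eq_tri, tri_eq_sum', tri_eq_sum', tri_eq_sum', tri_eq_sum', tri_eq_sum', Finset.mul_sum, ← Finset.sum_add_distrib,
      ← Finset.sum_sub_distrib, ← Finset.sum_sub_distrib, ← Finset.sum_sub_distrib]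
    refine Finset.sum_congr rfl fun q _ => ?_
    simp only [K, a𝒰, a𝒱, a𝒲, Set.mem_inter_iff, ite_and_eq_mul_any]
    ring
  rw [hsum, hN]

/-! ### Consequences -/

/-- The twisted shadow of an up-set family is an up-set of `[3]^d`. [this work] -/
theorem isUpperSet_twistedShadow (τ : Set (Fin d)) {𝒰 : Set (Set (Fin d))} (h𝒰 : IsUpperSet 𝒰) :
    IsUpperSet ((univ.filter fun x : Pd d => {a : Fin d | (a ∉ τ ∧ x a = 2) ∨ (a ∈ τ ∧ x a ≠ 0)} ∈ 𝒰 : Finset (Pd d)) : Set (Pd d)) := by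
  intro x y hxy hx
  rw [Finset.mem_coe, Finset.mem_filter] at hx ⊢
  refine ⟨Finset.mem_univ _, h𝒰 (fun a ha => ?_) hx.2⟩
  rcases ha with ⟨hτ, h2⟩ | ⟨hτ, h0⟩
  · refine Or.inl ⟨hτ, ?_⟩
    have h2' : (2 : Fin 3) ≤ y a := by rw [← h2]; exact hxy a
    exact le_antisymm (Fin.le_last _) h2'
  · refine Or.inr ⟨hτ, fun hy => h0 ?_⟩
    have : x a ≤ 0 := by rw [← hy]; exact hxy a
    exact le_antisymm this (Fin.zero_le _)

/-- **`PatternPos d ⟹` twisted three-partition positivity on the ground set `Fin d`** (every twist). [this work] -/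
theorem threePartNT_nonneg_of_patternPos (hP : PatternPos d) (τ : Set (Fin d)) {𝒰 𝒱 𝒲 : Set (Set (Fin d))} (h𝒰 : IsUpperSet 𝒰)
    (h𝒱 : IsUpperSet 𝒱) (h𝒲 : IsUpperSet 𝒲) : 0 ≤ threePartNT τ 𝒰 𝒱 𝒲 := by
  have h := hP _ _ _ (isUpperSet_twistedShadow τ h𝒰) (isUpperSet_twistedShadow τ h𝒱) (isUpperSet_twistedShadow τ h𝒲)
  rw [sStarD_twistedShadow_eq τ 𝒰 𝒱 𝒲 (fun x => by simp) (fun x => by simp) (fun x => by simp)] at h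
  exact nonneg_of_mul_nonneg_right (by rwa [mul_comm] at h) (by positivity)

/-- **Twisted three-partition positivity with one two-coordinate slot** (every `Fin d`, every twist, unconditional). [this work] -/
theorem threePartNT_nonneg_of_twoCoord (τ : Set (Fin d)) (i j : Fin d) (hij : i ≠ j) {𝒰 𝒱 𝒲 : Set (Set (Fin d))} (h𝒰 : IsUpperSet 𝒰)
    (hdep : ∀ S T : Set (Fin d), (i ∈ S ↔ i ∈ T) → (j ∈ S ↔ j ∈ T) → (S ∈ 𝒰 ↔ T ∈ 𝒰)) (h𝒱 : IsUpperSet 𝒱) (h𝒲 : IsUpperSet 𝒲) :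
    0 ≤ threePartNT τ 𝒰 𝒱 𝒲 := by
  have h := sStarD_nonneg_of_twoCoord i j hij (isUpperSet_twistedShadow τ h𝒰) (fun x y hi hj => by
      rw [Finset.mem_filter, Finset.mem_filter]
      simp only [Finset.mem_univ, true_and]
      exact hdep _ _ (by simp [hi]) (by simp [hj]))
    _ _ (isUpperSet_twistedShadow τ h𝒱) (isUpperSet_twistedShadow τ h𝒲)
  rw [sStarD_twistedShadow_eq τ 𝒰 𝒱 𝒲 (fun x => by simp) (fun x => by simp) (fun x => by simp)] at h
  exact nonneg_of_mul_nonneg_right (by rwa [mul_comm] at h) (by positivity)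

/-- **Twisted three-partition positivity with two independent slots** (every `Fin d`, every twist, unconditional). [this work] -/
theorem threePartNT_nonneg_of_indepSlots (τ : Set (Fin d)) (J : Finset (Fin d)) {𝒰 𝒱 𝒲 : Set (Set (Fin d))} (h𝒰 : IsUpperSet 𝒰)
    (h𝒱 : IsUpperSet 𝒱) (h𝒲 : IsUpperSet 𝒲) (hdep𝒰 : ∀ S T : Set (Fin d), (∀ a ∈ J, (a ∈ S ↔ a ∈ T)) → (S ∈ 𝒰 ↔ T ∈ 𝒰))
    (hdep𝒱 : ∀ S T : Set (Fin d), (∀ a ∉ J, (a ∈ S ↔ a ∈ T)) → (S ∈ 𝒱 ↔ T ∈ 𝒱)) :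
    0 ≤ threePartNT τ 𝒰 𝒱 𝒲 := by
  have h := sStarD_nonneg_of_indepSlots J (isUpperSet_twistedShadow τ h𝒰) (isUpperSet_twistedShadow τ h𝒱) (isUpperSet_twistedShadow τ h𝒲)
    (fun x y hxy => by
      rw [Finset.mem_filter, Finset.mem_filter]
      simp only [Finset.mem_univ, true_and]
      exact hdep𝒰 _ _ fun a ha => by simp [hxy a ha])
    (fun x y hxy => by
      rw [Finset.mem_filter, Finset.mem_filter]
      simp only [Finset.mem_univ, true_and]
      exact hdep𝒱 _ _ fun a ha => by simp [hxy a ha])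
  rw [sStarD_twistedShadow_eq τ 𝒰 𝒱 𝒲 (fun x => by simp) (fun x => by simp) (fun x => by simp)] at h
  exact nonneg_of_mul_nonneg_right (by rwa [mul_comm] at h) (by positivity)

/-! ### Transport along a bijection of the ground set, and the chain `PatternPos ⟹ (★★) ⟹ (M⁺-3)` -/

/-- Partition counts transport along an equivalence of ground sets (images of the parts). [this work] -/
theorem tri_image_equiv {ι ι' : Type*} [Fintype ι] [Fintype ι'] (e : ι ≃ ι') (p : Set ι' → Set ι' → Set ι' → Prop) :
    ThreePartition.tri p = ThreePartition.tri fun S₁ S₂ S₃ : Set ι => p (e '' S₁) (e '' S₂) (e '' S₃) := by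
  unfold ThreePartition.tri
  symm
  refine card_bij' (fun q _ => (e '' q.1, e '' q.2)) (fun q _ => (e ⁻¹' q.1, e ⁻¹' q.2)) ?_ ?_ ?_ ?_
  · intro q hq
    simp only [mem_filter, mem_univ, true_and] at hq ⊢
    refine ⟨(Set.disjoint_image_iff e.injective).2 hq.1, ?_⟩
    rw [← Set.image_union, ← Set.image_compl_eq e.bijective]
    exact hq.2
  · intro q hq
    simp only [mem_filter, mem_univ, true_and] at hq ⊢
    rw [Set.image_preimage_eq _ e.surjective, Set.image_preimage_eq _ e.surjective, ← Set.preimage_union, ← Set.preimage_compl,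
      Set.image_preimage_eq _ e.surjective]
    exact ⟨hq.1.preimage e, hq.2⟩
  · intro q _
    exact Prod.ext (Set.preimage_image_eq _ e.injective) (Set.preimage_image_eq _ e.injective)
  · intro q _
    exact Prod.ext (Set.image_preimage_eq _ e.surjective) (Set.image_preimage_eq _ e.surjective)

/-- The twisted functional transports along an equivalence of ground sets: pull the families and the twist back. [this work] -/
theorem threePartNT_image_equiv {ι ι' : Type*} [Fintype ι] [Fintype ι'] (e : ι ≃ ι') (τ : Set ι') (𝒰 𝒱 𝒲 : Set (Set ι')) :
    threePartNT τ 𝒰 𝒱 𝒲 =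
      threePartNT (e ⁻¹' τ) {S : Set ι | e '' S ∈ 𝒰} {S : Set ι | e '' S ∈ 𝒱} {S : Set ι | e '' S ∈ 𝒲} := by
  have himg : ∀ S : Set ι, e '' (S ∆ (e ⁻¹' τ)) = (e '' S) ∆ τ := by
    intro S
    rw [Set.image_symmDiff e.injective, Set.image_preimage_eq _ e.surjective]
  have key : ∀ p : Set ι' → Set ι' → Set ι' → Prop,
      triT τ p = triT (e ⁻¹' τ) (fun S₁ S₂ S₃ : Set ι => p (e '' S₁) (e '' S₂) (e '' S₃)) := by
    intro p
    unfold triT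
    rw [tri_image_equiv e]
    refine tri_congr fun S₁ S₂ _ => ?_
    show _ ↔ p (e '' (S₁ ∆ (e ⁻¹' τ))) (e '' (S₂ ∆ (e ⁻¹' τ))) (e '' ((S₁ ∪ S₂)ᶜ ∆ (e ⁻¹' τ)))
    rw [himg, himg, himg]
  unfold threePartNT topT deeT teeT
  rw [key, key, key, key, key]
  rfl

/-- **The pattern conjecture implies the twisted three-partition conjecture (★★).** [this work] -/
theorem threePartitionPositivityTwisted_of_forall_patternPos (hP : ∀ d, PatternPos d) : ThreePartitionPositivityTwisted := by
  intro ι _ τ 𝒰 𝒱 𝒲 h𝒰 h𝒱 h𝒲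
  let e : Fin (Fintype.card ι) ≃ ι := (Fintype.equivFin ι).symm
  rw [threePartNT_image_equiv e]
  have hup : ∀ {𝒳 : Set (Set ι)}, IsUpperSet 𝒳 → IsUpperSet {S : Set (Fin (Fintype.card ι)) | e '' S ∈ 𝒳} :=
    fun h𝒳 S T hST hS => h𝒳 (Set.image_mono hST) hS
  exact threePartNT_nonneg_of_patternPos (hP _) _ (hup h𝒰) (hup h𝒱) (hup h𝒲)

/-- **The pattern conjecture implies comb positivity of Sahi's `E₃` on every finite cube (M⁺-3)**, through (★★) and the bridge of
`…ThreePartitionCombBridge`. [this work] -/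
theorem masterFamilyCombPos_three_of_forall_patternPos (hP : ∀ d, PatternPos d) : MasterFamilyCombPos 3 :=
  masterFamilyCombPos_three_of_threePartitionPositivityTwisted (threePartitionPositivityTwisted_of_forall_patternPos hP)

end Summit.CriticalPhenomena.PercolationContinuityZ3.Theorems.SahiGridPattern
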